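import Literature.AnabelianGeometry.SemiGraphs.TemperedStrictlyCoherent
import Literature.AnabelianGeometry.SemiGraphs.EtaleOfTemperedCoveringProofs
import Literature.AnabelianGeometry.SemiGraphs.TemperedVerticialInjective
import Literature.AnabelianGeometry.AbsoluteAnabelian.CharacteristicOpenSubgroups
import Literature.AnabelianGeometry.AbsoluteAnabelian.TopFGOpenSubgroups
import Mathlib.Combinatorics.SimpleGraph.Connectivity.Connected
import HarnessLib

/-!
# `UniformSplitting` for strictly coherent semi-graphs; Proposition 3.6 (v) for finite coherent `G`

Mochizuki, *Semi-graphs of anabelioids*, Publ. RIMS **42** (2006), proof of Prop. 3.6 (v) p. 40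
[cite: MochizukiSemiAnbd2006, Prop 3.6(v) p.40], with the uniformity of [IUTchI] Rmk. 2.5.3 (i)
(T3)/(T4) [cite: Mochizuki2012, IUTchI Rem. 2.5.3(i)(T3) p.53]. For `G` as in Proposition 3.6 and
STRICTLY coherent (`ProfiniteSemiGraph.IsStrictlyCoherent`: all `Π_c` topologically `N`-generated),
`S` tempered and `H` a finite object of `B^cov(G_S)`, print's sentence "it follows from the coherence
of `G` that there exists a finite étale covering `H~ → G` whose pull-back to `G'` splits the restrictions
of `H → G'` to each of the `G'_{c'}`" is PROVED (`uniformSplittingAt_of_isStrictlyCoherent`):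

1. degrees are constant on components (`nodeCard_eq_of_reachable`): `D` = degree of a finite covering
   `F₀` of `G` splitting the component of `S` under `H`, `d` = degree of `H` on the component;
2. at each constituent `c` the subgroup `N'_{c'} = {k ∈ Stab(x_{c'}) | k` fixes `H_{c'}` pointwise`}`
   has index `≤ K := D · d!` in `Π_c`;
3. (T4) uniformity (`CharacteristicOpenSubgroups`, abc-iut-L3-t7): an open normal `U_c ⊆ Π_c` of index
   `≤ (K!)^((K!)^N)` lies in every open subgroup of index `≤ K`, so `U_c ⊆ N'_{c'}` for all `c'` over `c`;
4. quasi-coherence (Def. 2.3 (iii)) applied to the bounded family `Π_c/U_c` gives an approximator `A`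
   with `Ker(Π_c → A_c) ⊆ U_c`, and the trivialising covering of `A` (`Approximator.trivCov`,
   abc-iut-L3-t8: print's Prop. 2.5 construction) is a finite object of `B^cov(G)` whose point
   stabilisers are these kernels — its pull-back to `G_S` splits `H` on the component.

Consequences: `etaleEquivOfStrictlyCoherent` (`B^temp(G_S) ≌ B^temp(G)_S` for strictly coherent `G`,
unconditionally), `isStrictlyCoherent_of_finite` ((T3): finite and coherent ⇒ strictly coherent) and
`nonempty_etaleEquiv_of_finite` — Proposition 3.6 (v) UNCONDITIONALLY for finite coherent `G` (the
range needed for the dual semi-graphs of pointed stable curves).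
-/

noncomputable section

open CategoryTheory Topology

namespace Literature.AnabelianGeometry.SemiGraphs

open Literature.AlgebraicGeometry.Frobenioids.QuasiTemperoid.BTempConnected (hom_ρ hom_ext_apply
  ρ_one_apply ρ_mul_apply ρ_inv_apply)
open GaloisObjects (iso_inv_hom_apply iso_hom_inv_apply)
open Literature.AnabelianGeometry.AbsoluteAnabelian.IsTopologicallyFinitelyGenerated
  (exists_open_normal_le_ker le_ker_of_card_le isOpen_ker_permRep eq_comap_stabilizer_permRep)

universe u

namespace ProfiniteSemiGraph

namespace CovObj

variable {𝒢 : ProfiniteSemiGraph.{u}}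

/-! ### 1. Degrees are constant on connected components -/

/-- The cardinality of the fibre of `F` at a node of the barycentric subdivision (a branch node
carries the fibre of its edge). [cite: MochizukiSemiAnbd2006, Def 3.5(i) p.37] -/
def nodeCard (F : CovObj 𝒢) : 𝒢.graph.Node → ℕ
  | Sum.inl v => Nat.card (F.SV v).obj.V
  | Sum.inr (Sum.inl e) => Nat.card (F.SE e).obj.V
  | Sum.inr (Sum.inr b) => Nat.card (F.SE (𝒢.graph.edgeOf b)).obj.V

/-- The underlying bijection of an isomorphism of `B^temp(Π)`. [cite: MochizukiSemiAnbd2006, §3 p.33] -/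
def equivOfIso {G : Type u} [Group G] [TopologicalSpace G] {X Y : BTemp G} (e : X ≅ Y) :
    X.obj.V ≃ Y.obj.V where
  toFun x := e.hom.hom.hom x
  invFun y := e.inv.hom.hom y
  left_inv x := iso_inv_hom_apply e x
  right_inv y := iso_hom_inv_apply e y

/-- Adjacent nodes carry fibres of the same cardinality (the gluings are bijections).
[cite: MochizukiSemiAnbd2006, §3 p.36] -/
theorem nodeCard_eq_of_nodeRel (F : CovObj 𝒢) {m n : 𝒢.graph.Node} (h : 𝒢.graph.NodeRel m n) :
    F.nodeCard m = F.nodeCard n := by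
  cases h with
  | edge_branch b => rfl
  | branch_vertex b v hb => exact Nat.card_congr (equivOfIso (F.glue b v hb))

/-- Nodes of one connected component carry fibres of the same cardinality.
[cite: MochizukiSemiAnbd2006, §3 p.36] -/
theorem nodeCard_eq_of_reachable (F : CovObj 𝒢) {m n : 𝒢.graph.Node}
    (h : 𝒢.graph.subdivision.Reachable m n) : F.nodeCard m = F.nodeCard n := by
  rw [SimpleGraph.reachable_iff_reflTransGen] at h
  induction h with
  | refl => rfl
  | tail _ hbc ih =>
    rw [ih]
    obtain ⟨_, h | h⟩ := (SimpleGraph.fromRel_adj _ _ _).mp hbc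
    · exact F.nodeCard_eq_of_nodeRel h
    · exact (F.nodeCard_eq_of_nodeRel h).symm

/-! ### Components of a covering of `G_S`: nodes visited, base points in `S` -/

variable (S : CovObj 𝒢)

/-- The node of `G_S` under a point of an object of `B^cov(G_S)`. [cite: MochizukiSemiAnbd2006, Def 3.5(i) p.37] -/
def idxNode (H : CovObj S.coveringGraph) : H.Point → S.coveringGraph.graph.Node
  | Sum.inl ⟨v', _⟩ => Sum.inl v'
  | Sum.inr ⟨e', _⟩ => Sum.inr (Sum.inl e')

/-- Adjacent points of `H` lie over reachable nodes of `G_S`. [cite: MochizukiSemiAnbd2006, Def 3.5(ii) p.37] -/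
theorem reachable_idxNode_of_adj (H : CovObj S.coveringGraph) {p q : H.Point} (h : H.Adj p q) :
    S.coveringGraph.graph.subdivision.Reachable (S.idxNode H p) (S.idxNode H q) := by
  cases h with
  | vertex v' k x => exact SimpleGraph.Reachable.refl _
  | edge e' k x => exact SimpleGraph.Reachable.refl _
  | glue b' v' h' x =>
    have h1 : S.coveringGraph.graph.subdivision.Reachable
        (Sum.inr (Sum.inl (S.coveringGraph.graph.edgeOf b'))) (Sum.inr (Sum.inr b')) :=
      SimpleGraph.Adj.reachable ((SimpleGraph.fromRel_adj _ _ _).mpr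
        ⟨by simp, Or.inl (SemiGraph.NodeRel.edge_branch b')⟩)
    have h2 : S.coveringGraph.graph.subdivision.Reachable (Sum.inr (Sum.inr b')) (Sum.inl v') :=
      SimpleGraph.Adj.reachable ((SimpleGraph.fromRel_adj _ _ _).mpr
        ⟨by simp, Or.inl (SemiGraph.NodeRel.branch_vertex b' v' h')⟩)
    exact h1.trans h2

/-- Points of one component of `H` lie over reachable nodes of `G_S`.
[cite: MochizukiSemiAnbd2006, Def 3.5(ii) p.37] -/
theorem reachable_idxNode (H : CovObj S.coveringGraph) {p q : H.Point} (h : H.SameComponent p q) :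
    S.coveringGraph.graph.subdivision.Reachable (S.idxNode H p) (S.idxNode H q) := by
  induction h with
  | rel a b hab => exact S.reachable_idxNode_of_adj H hab
  | refl a => exact SimpleGraph.Reachable.refl _
  | symm a b _ ih => exact ih.symm
  | trans a b c _ _ ih₁ ih₂ => exact ih₁.trans ih₂

/-- The base point in `S` of a node of `G_S`. [cite: MochizukiSemiAnbd2006, Def 3.5(i) p.37] -/
def nodeBase : S.coveringGraph.graph.Node → S.Point
  | Sum.inl v' => Sum.inl ⟨v'.1, Quot.out v'.2⟩
  | Sum.inr (Sum.inl e') => Sum.inr ⟨e'.1, Quot.out e'.2⟩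
  | Sum.inr (Sum.inr b') => Sum.inr ⟨𝒢.graph.edgeOf b'.1, Quot.out b'.2⟩

/-- Adjacent nodes of `G_S` have base points in one component of `S`.
[cite: MochizukiSemiAnbd2006, Def 3.5(i) p.37] -/
theorem sameComponent_nodeBase_of_nodeRel {m n : S.coveringGraph.graph.Node}
    (h : S.coveringGraph.graph.NodeRel m n) : S.SameComponent (S.nodeBase m) (S.nodeBase n) := by
  cases h with
  | edge_branch b' => exact Relation.EqvGen.refl _
  | branch_vertex b' v' h' =>
    obtain ⟨b, ω⟩ := b'
    obtain ⟨v, ωv⟩ := v'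
    refine Relation.EqvGen.trans _ _ _
      (Relation.EqvGen.rel _ _ (Adj.glue b v (S.abuts_of_coveringAbuts h') (Quot.out ω)))
      (Relation.EqvGen.rel _ _ ?_)
    have := Adj.vertex (S := S) v (S.conjugator h')
      ((S.glue b v (S.abuts_of_coveringAbuts h')).hom.hom.hom (Quot.out ω))
    rwa [S.conjugator_spec h'] at this

/-- Reachable nodes of `G_S` have base points in one component of `S`.
[cite: MochizukiSemiAnbd2006, Def 3.5(i) p.37] -/
theorem sameComponent_nodeBase {m n : S.coveringGraph.graph.Node}
    (h : S.coveringGraph.graph.subdivision.Reachable m n) :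
    S.SameComponent (S.nodeBase m) (S.nodeBase n) := by
  rw [SimpleGraph.reachable_iff_reflTransGen] at h
  induction h with
  | refl => exact Relation.EqvGen.refl _
  | tail _ hbc ih =>
    refine Relation.EqvGen.trans _ _ _ ih ?_
    obtain ⟨_, h | h⟩ := (SimpleGraph.fromRel_adj _ _ _).mp hbc
    · exact S.sameComponent_nodeBase_of_nodeRel h
    · exact Relation.EqvGen.symm _ _ (S.sameComponent_nodeBase_of_nodeRel h)

/-! ### 2. Index bounds -/

section IndexBounds

variable {G : Type u} [Group G] [TopologicalSpace G]

/-- If a finite `F₀` splits `X` at `s`, the stabiliser of `s` has finite index at most `|F₀|`: it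
contains the stabiliser of any point of `F₀`, whose index is the size of an orbit.
[cite: MochizukiSemiAnbd2006, Def 3.5(ii) p.37] -/
theorem index_stab_le {F₀ X : BTemp G} [Finite F₀.obj.V] (x₀ : F₀.obj.V) (s : X.obj.V)
    (h : ∀ (x : F₀.obj.V) (g : G), F₀.obj.ρ g x = x → X.obj.ρ g s = s) :
    (BTemp.stab X s).index ≠ 0 ∧ (BTemp.stab X s).index ≤ Nat.card F₀.obj.V := by
  letI : MulAction G F₀.obj.V := Action.instMulAction F₀.obj
  have hle : MulAction.stabilizer G x₀ ≤ BTemp.stab X s := fun g hg => h x₀ g hg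
  have h1 : (BTemp.stab X s).index ∣ (MulAction.stabilizer G x₀).index := Subgroup.index_dvd_of_le hle
  have h2 : (MulAction.stabilizer G x₀).index = Nat.card (MulAction.orbit G x₀) :=
    Nat.card_congr (MulAction.orbitEquivQuotientStabilizer G x₀).symm
  have h3 : Nat.card (MulAction.orbit G x₀) ≤ Nat.card F₀.obj.V :=
    Nat.card_le_card_of_injective (fun y : MulAction.orbit G x₀ => (y : F₀.obj.V))
      Subtype.val_injective
  have h4 : Nat.card (MulAction.orbit G x₀) ≠ 0 :=
    Nat.card_ne_zero.mpr ⟨⟨⟨x₀, MulAction.mem_orbit_self x₀⟩⟩, inferInstance⟩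
  have h5 : (MulAction.stabilizer G x₀).index ≠ 0 := by rw [h2]; exact h4
  refine ⟨fun h0 => h5 (Nat.eq_zero_of_zero_dvd (h0 ▸ h1)), ?_⟩
  calc (BTemp.stab X s).index ≤ (MulAction.stabilizer G x₀).index :=
        Nat.le_of_dvd (Nat.pos_of_ne_zero h5) h1
    _ ≤ Nat.card F₀.obj.V := by rw [h2]; exact h3

/-- The pointwise stabiliser ("fixator") of a finite object `Y ∈ B^temp(L)`.
[cite: MochizukiSemiAnbd2006, §3 p.33] -/
def fixator {L : Type u} [Group L] [TopologicalSpace L] (Y : BTemp L) : Subgroup L :=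
  letI : MulAction L Y.obj.V := Action.instMulAction Y.obj
  (MulAction.toPermHom L Y.obj.V).ker

/-- Membership in the fixator. [cite: MochizukiSemiAnbd2006, §3 p.33] -/
theorem mem_fixator_iff {L : Type u} [Group L] [TopologicalSpace L] (Y : BTemp L) (k : L) :
    k ∈ fixator Y ↔ ∀ y : Y.obj.V, Y.obj.ρ k y = y := by
  letI : MulAction L Y.obj.V := Action.instMulAction Y.obj
  change (MulAction.toPermHom L Y.obj.V) k = 1 ↔ _
  rw [Equiv.ext_iff]
  rfl

/-- The fixator of a finite object has index at most `|Y|!`. [cite: MochizukiSemiAnbd2006, §3 p.33] -/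
theorem index_fixator_le {L : Type u} [Group L] [TopologicalSpace L] (Y : BTemp L) [Finite Y.obj.V] :
    (fixator Y).index ≤ (Nat.card Y.obj.V).factorial := by
  classical
  letI : MulAction L Y.obj.V := Action.instMulAction Y.obj
  letI : Fintype Y.obj.V := Fintype.ofFinite _
  change (MulAction.toPermHom L Y.obj.V).ker.index ≤ _
  rw [Subgroup.index_ker]
  calc Nat.card (MulAction.toPermHom L Y.obj.V).range ≤ Nat.card (Equiv.Perm Y.obj.V) :=
        Nat.card_le_card_of_injective _ Subtype.val_injective
    _ = (Nat.card Y.obj.V).factorial := by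
        rw [Nat.card_eq_fintype_card, Fintype.card_perm, Nat.card_eq_fintype_card]

/-- The fixator of a finite object has finite (nonzero) index. [cite: MochizukiSemiAnbd2006, §3 p.33] -/
theorem index_fixator_ne_zero {L : Type u} [Group L] [TopologicalSpace L] (Y : BTemp L)
    [Finite Y.obj.V] : (fixator Y).index ≠ 0 := by
  classical
  letI : MulAction L Y.obj.V := Action.instMulAction Y.obj
  change (MulAction.toPermHom L Y.obj.V).ker.index ≠ 0
  rw [Subgroup.index_ker]
  exact Nat.card_ne_zero.mpr ⟨⟨⟨1, one_mem _⟩⟩, inferInstance⟩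

/-- The fixator of a finite object is open. [cite: MochizukiSemiAnbd2006, §3 p.33] -/
theorem isOpen_fixator {L : Type u} [Group L] [TopologicalSpace L] (Y : BTemp L) [Finite Y.obj.V] :
    IsOpen (fixator Y : Set L) := by
  have : (fixator Y : Set L) = ⋂ y : Y.obj.V, {k : L | Y.obj.ρ k y = y} := by
    ext k
    simp only [SetLike.mem_coe, mem_fixator_iff, Set.mem_iInter, Set.mem_setOf_eq]
  rw [this]
  exact isOpen_iInter_of_finite fun y => Y.property.2 y

/-- The subgroup `N' = {k ∈ L | k` fixes `Y` pointwise`}` of `Π`, for an open subgroup `L ⊆ Π` and a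
finite `Y ∈ B^temp(L)`: open, of index `[Π : L] · [L : fixator]`. [cite: MochizukiSemiAnbd2006, §3 p.33] -/
def fixatorIn (L : Subgroup G) (Y : BTemp L) : Subgroup G :=
  (fixator Y).map L.subtype

/-- Membership in `N'`. [cite: MochizukiSemiAnbd2006, §3 p.33] -/
theorem mem_fixatorIn_iff (L : Subgroup G) (Y : BTemp L) (k : L) :
    (k : G) ∈ fixatorIn L Y ↔ k ∈ fixator Y := by
  constructor
  · rintro ⟨k', hk', hkk'⟩
    have : k' = k := Subtype.ext hkk'
    rwa [this] at hk'
  · intro hk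
    exact ⟨k, hk, rfl⟩

/-- The index of `N'`. [cite: MochizukiSemiAnbd2006, §3 p.33] -/
theorem index_fixatorIn (L : Subgroup G) (Y : BTemp L) :
    (fixatorIn L Y).index = (fixator Y).index * L.index :=
  Subgroup.index_map_subtype _

/-- `N'` is open for `L` open and `Y` finite. [cite: MochizukiSemiAnbd2006, §3 p.33] -/
theorem isOpen_fixatorIn (L : Subgroup G) (hL : IsOpen (L : Set G)) (Y : BTemp L) [Finite Y.obj.V] :
    IsOpen (fixatorIn L Y : Set G) := by
  have : (fixatorIn L Y : Set G) = Subtype.val '' (fixator Y : Set L) := by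
    ext g
    constructor
    · rintro ⟨k, hk, rfl⟩
      exact ⟨k, hk, rfl⟩
    · rintro ⟨k, hk, rfl⟩
      exact ⟨k, hk, rfl⟩
  rw [this]
  exact hL.isOpenMap_subtype_val _ (isOpen_fixator Y)

/-- (T4) consequence: a subgroup contained in the kernel of every open-kernel permutation
representation on `≤ K` letters lies in every open subgroup of index `≤ K`.
[cite: Mochizuki2012, IUTchI Rem. 2.5.3(i)(T4) p.53] -/
theorem le_of_index_le [IsTopologicalGroup G] {K : ℕ} (U : Subgroup G)
    (hU : ∀ ρ : G →* Equiv.Perm (Fin K), IsOpen (ρ.ker : Set G) → U ≤ ρ.ker)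
    (N : Subgroup G) (hN : IsOpen (N : Set G)) (hNi : N.index ≠ 0) (hNK : N.index ≤ K) : U ≤ N := by
  classical
  haveI : N.FiniteIndex := ⟨hNi⟩
  let e : G ⧸ N ≃ Fin N.index := Finite.equivFin (G ⧸ N)
  let ρ := e.permCongrHom.toMonoidHom.comp (MulAction.toPermHom G (G ⧸ N))
  have h1 : U ≤ ρ.ker :=
    le_ker_of_card_le (X := Fin N.index) (by rwa [Nat.card_eq_fintype_card, Fintype.card_fin]) U hU ρ
      (isOpen_ker_permRep N hN e)
  have h2 : ρ.ker ≤ N := by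
    conv_rhs => rw [eq_comap_stabilizer_permRep N e]
    exact fun g hg => by
      rw [Subgroup.mem_comap, MulAction.mem_stabilizer_iff, MonoidHom.mem_ker.mp hg, one_smul]
  exact h1.trans h2

end IndexBounds

/-! ### 3.–4. The finite covering -/

/-- A finite `Π`-set of cosets, as an object of `B^temp(Π)` (the family fed to quasi-coherence).
[cite: MochizukiSemiAnbd2006, Def 2.3(iii) p.25] -/
def cosetsObj {G : Type u} [Group G] [TopologicalSpace G] [IsTopologicalGroup G] (U : Subgroup G)
    (hU : IsOpen (U : Set G)) (hUi : U.index ≠ 0) : BTemp G :=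
  ⟨Action.ofMulAction G (G ⧸ U), by
    haveI : U.FiniteIndex := ⟨hUi⟩
    exact ⟨inferInstanceAs (Countable (G ⧸ U)), fun q =>
      Literature.AnabelianGeometry.AbsoluteAnabelian.IsTopologicallyFinitelyGenerated.isOpen_setOf_smul_eq
        U hU q⟩⟩

/-- If `g` fixes every coset of `U` then `g ∈ U`. [cite: MochizukiSemiAnbd2006, Def 2.3(iii) p.25] -/
theorem mem_of_cosetsObj_fixed {G : Type u} [Group G] [TopologicalSpace G] [IsTopologicalGroup G]
    (U : Subgroup G) (hU : IsOpen (U : Set G)) (hUi : U.index ≠ 0) (g : G)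
    (h : ∀ x : (cosetsObj U hU hUi).obj.V, (cosetsObj U hU hUi).obj.ρ g x = x) : g ∈ U := by
  have h1 : g • ((1 : G) : G ⧸ U) = ((1 : G) : G ⧸ U) := h ((1 : G) : G ⧸ U)
  rw [MulAction.Quotient.smul_coe, smul_eq_mul, mul_one, QuotientGroup.eq, mul_one, inv_mem_iff] at h1
  exact h1

/-- The point stabilisers of the trivialising covering of an approximator are the kernels
`Ker(Π_v → A_v)`. [cite: MochizukiSemiAnbd2006, Prop 2.5 p.27] -/
theorem πV_eq_one_of_trivCov_ρ_eq (A : 𝒢.Approximator) {M : ℕ} (hM : 0 < M)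
    (hdvd : ∀ w, Nat.card (A.FV w) ∣ M) (v : 𝒢.graph.Vertex)
    (z : ((A.trivCov hM hdvd).SV v).obj.V) (g : 𝒢.Gv v) (hz : ((A.trivCov hM hdvd).SV v).obj.ρ g z = z) :
    A.πV v g = 1 := by
  change (A.πV v g * z.1, z.2) = z at hz
  exact mul_eq_right.mp (congrArg Prod.fst hz)

/-- Edge version. [cite: MochizukiSemiAnbd2006, Prop 2.5 p.27] -/
theorem πE_eq_one_of_trivCov_ρ_eq (A : 𝒢.Approximator) {M : ℕ} (hM : 0 < M)
    (hdvd : ∀ w, Nat.card (A.FV w) ∣ M) (e : 𝒢.graph.Edge)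
    (z : ((A.trivCov hM hdvd).SE e).obj.V) (g : 𝒢.Ge e) (hz : ((A.trivCov hM hdvd).SE e).obj.ρ g z = z) :
    A.πE e g = 1 := by
  change (A.πE e g * z.1, z.2) = z at hz
  exact mul_eq_right.mp (congrArg Prod.fst hz)

/-- Monotonicity of the (T4) bound in the number of generators. [cite: Mochizuki2012, IUTchI Rem. 2.5.3(i)(T4) p.53] -/
theorem bound_mono {K a b : ℕ} (h : a ≤ b) :
    (K.factorial) ^ ((K.factorial) ^ a) ≤ (K.factorial) ^ ((K.factorial) ^ b) :=
  Nat.pow_le_pow_right (Nat.factorial_pos K) (Nat.pow_le_pow_right (Nat.factorial_pos K) h)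

/-- **`UniformSplitting` holds at every tempered `S` over a strictly coherent `G`** (as in Prop. 3.6):
the covering-construction step of the proof of [SemiAnbd] Prop. 3.6 (v) (p. 40), with the uniform
index bound of [IUTchI] Rmk. 2.5.3 (i) (T4). [cite: MochizukiSemiAnbd2006, Prop 3.6(v) p.40] -/
theorem uniformSplittingAt_of_isStrictlyCoherent (h36 : 𝒢.Prop36Hypotheses)
    (hsc : 𝒢.IsStrictlyCoherent) (hS : S.IsTempered) : S.UniformSplittingAt := by
  classical
  intro H hH p
  haveI : ∀ v', Finite (H.SV v').obj.V := hH.finite_V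
  haveI : ∀ e', Finite (H.SE e').obj.V := hH.finite_E
  obtain ⟨N, -, hgenV, hgenE⟩ := hsc.exists_bound
  -- `F₀` splitting the component of `S` under `p`
  obtain ⟨F₀, h0fin, h0ne, h0split⟩ := hS (S.nodeBase (S.idxNode H p))
  haveI : ∀ v, Finite (F₀.SV v).obj.V := h0fin.finite_V
  haveI : ∀ e, Finite (F₀.SE e).obj.V := h0fin.finite_E
  -- the degrees
  obtain ⟨v₀⟩ := h36.hasVertex
  let D : ℕ := F₀.nodeCard (Sum.inl v₀)
  have hD : ∀ n : 𝒢.graph.Node, F₀.nodeCard n = D := fun n =>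
    F₀.nodeCard_eq_of_reachable (h36.isConnected.connected.preconnected n (Sum.inl v₀))
  let d : ℕ := H.nodeCard (S.idxNode H p)
  have hd : ∀ q : H.Point, H.SameComponent p q → H.nodeCard (S.idxNode H q) = d := fun q hq =>
    (H.nodeCard_eq_of_reachable (S.reachable_idxNode H hq)).symm
  let K : ℕ := D * d.factorial
  -- (T4): the characteristic open subgroups `U_v`, `U_e` of bounded index
  let β : ℕ := (K.factorial) ^ ((K.factorial) ^ N)
  have hUV : ∀ v : 𝒢.graph.Vertex, ∃ U : Subgroup (𝒢.Gv v), IsOpen (U : Set (𝒢.Gv v)) ∧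
      U.index ≠ 0 ∧ U.index ≤ β ∧
      ∀ ρ : 𝒢.Gv v →* Equiv.Perm (Fin K), IsOpen (ρ.ker : Set (𝒢.Gv v)) → U ≤ ρ.ker := by
    intro v
    obtain ⟨s, hs, hgen⟩ := hgenV v
    obtain ⟨U, -, hUo, hUi, hUβ, hUker⟩ := exists_open_normal_le_ker s hgen K
    exact ⟨U, hUo, hUi, hUβ.trans (bound_mono hs), hUker⟩
  have hUE : ∀ e : 𝒢.graph.Edge, ∃ U : Subgroup (𝒢.Ge e), IsOpen (U : Set (𝒢.Ge e)) ∧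
      U.index ≠ 0 ∧ U.index ≤ β ∧
      ∀ ρ : 𝒢.Ge e →* Equiv.Perm (Fin K), IsOpen (ρ.ker : Set (𝒢.Ge e)) → U ≤ ρ.ker := by
    intro e
    obtain ⟨s, hs, hgen⟩ := hgenE e
    obtain ⟨U, -, hUo, hUi, hUβ, hUker⟩ := exists_open_normal_le_ker s hgen K
    exact ⟨U, hUo, hUi, hUβ.trans (bound_mono hs), hUker⟩
  choose UV hUVo hUVi hUVβ hUVker using hUV
  choose UE hUEo hUEi hUEβ hUEker using hUE
  -- quasi-coherence applied to the cosets of the `U_c`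
  haveI : ∀ v, (UV v).FiniteIndex := fun v => ⟨hUVi v⟩
  haveI : ∀ e, (UE e).FiniteIndex := fun e => ⟨hUEi e⟩
  obtain ⟨A, hAV, hAE⟩ := h36.isQuasiCoherent β (fun v => cosetsObj (UV v) (hUVo v) (hUVi v))
    (fun e => cosetsObj (UE e) (hUEo e) (hUEi e))
    (fun v => ⟨hUVβ v, inferInstanceAs (Finite (𝒢.Gv v ⧸ UV v))⟩)
    (fun e => ⟨hUEβ e, inferInstanceAs (Finite (𝒢.Ge e ⧸ UE e))⟩)
  have hkerV : ∀ v (g : 𝒢.Gv v), A.πV v g = 1 → g ∈ UV v := fun v g hg =>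
    mem_of_cosetsObj_fixed (UV v) (hUVo v) (hUVi v) g (hAV v g hg)
  have hkerE : ∀ e (g : 𝒢.Ge e), A.πE e g = 1 → g ∈ UE e := fun e g hg =>
    mem_of_cosetsObj_fixed (UE e) (hUEo e) (hUEi e) g (hAE e g hg)
  -- the trivialising covering of `A`
  obtain ⟨M, hM, hdvd⟩ := A.bounded
  refine ⟨A.trivCov hM hdvd, A.trivCov_isFinite hM hdvd, A.trivCov_hasNonemptyFibres hM hdvd,
    fun q hq => ?_⟩
  -- at a point `q` of the component of `p`: base point in the component of `S` under `p`, degree `d`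
  have hbase : S.SameComponent (S.nodeBase (S.idxNode H p)) (S.nodeBase (S.idxNode H q)) :=
    S.sameComponent_nodeBase (S.reachable_idxNode H hq)
  have hdq := hd q hq
  rcases q with ⟨⟨v, ω⟩, y⟩ | ⟨⟨e, ω⟩, y⟩
  · -- vertex point: `k ∈ Stab(x_ω)` fixing a point of the trivialising covering fixes `y`
    intro z k hz
    have hk1 : A.πV v (k : 𝒢.Gv v) = 1 := πV_eq_one_of_trivCov_ρ_eq A hM hdvd v z k hz
    have hkU : (k : 𝒢.Gv v) ∈ UV v := hkerV v k hk1
    -- the subgroup `N'` of `k ∈ Stab` fixing `H_{(v,ω)}` pointwise has index `≤ K`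
    let L : Subgroup (𝒢.Gv v) := BTemp.stab (S.SV v) (Quot.out ω)
    have hL : IsOpen (L : Set (𝒢.Gv v)) := (S.SV v).property.2 _
    obtain ⟨x₀⟩ := h0ne.nonempty_V v
    obtain ⟨hLi0, hLi⟩ := index_stab_le (X := S.SV v) x₀ (Quot.out ω) (h0split _ hbase)
    have hDv : Nat.card (F₀.SV v).obj.V = D := hD (Sum.inl v)
    have hdv : Nat.card (H.SV ⟨v, ω⟩).obj.V = d := hdq
    have hN'K : (fixatorIn L (H.SV ⟨v, ω⟩)).index ≤ K := by
      rw [index_fixatorIn]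
      calc (fixator (H.SV ⟨v, ω⟩)).index * L.index
          ≤ (Nat.card (H.SV ⟨v, ω⟩).obj.V).factorial * Nat.card (F₀.SV v).obj.V :=
            Nat.mul_le_mul (index_fixator_le _) hLi
        _ = K := by rw [hdv, hDv, Nat.mul_comm]
    have hN'0 : (fixatorIn L (H.SV ⟨v, ω⟩)).index ≠ 0 := by
      rw [index_fixatorIn]
      exact Nat.mul_ne_zero (index_fixator_ne_zero _) hLi0
    have hUN' : UV v ≤ fixatorIn L (H.SV ⟨v, ω⟩) :=
      le_of_index_le (UV v) (hUVker v) _ (isOpen_fixatorIn L hL _) hN'0 hN'K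
    have hkfix : k ∈ fixator (H.SV ⟨v, ω⟩) := (mem_fixatorIn_iff L _ k).mp (hUN' hkU)
    exact (mem_fixator_iff _ _).mp hkfix y
  · -- edge point: the same with `Π_e`
    intro z k hz
    have hk1 : A.πE e (k : 𝒢.Ge e) = 1 := πE_eq_one_of_trivCov_ρ_eq A hM hdvd e z k hz
    have hkU : (k : 𝒢.Ge e) ∈ UE e := hkerE e k hk1
    let L : Subgroup (𝒢.Ge e) := BTemp.stab (S.SE e) (Quot.out ω)
    have hL : IsOpen (L : Set (𝒢.Ge e)) := (S.SE e).property.2 _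
    obtain ⟨x₀⟩ := h0ne.nonempty_E e
    obtain ⟨hLi0, hLi⟩ := index_stab_le (X := S.SE e) x₀ (Quot.out ω) (h0split _ hbase)
    have hDe : Nat.card (F₀.SE e).obj.V = D := hD (Sum.inr (Sum.inl e))
    have hde : Nat.card (H.SE ⟨e, ω⟩).obj.V = d := hdq
    have hN'K : (fixatorIn L (H.SE ⟨e, ω⟩)).index ≤ K := by
      rw [index_fixatorIn]
      calc (fixator (H.SE ⟨e, ω⟩)).index * L.index
          ≤ (Nat.card (H.SE ⟨e, ω⟩).obj.V).factorial * Nat.card (F₀.SE e).obj.V :=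
            Nat.mul_le_mul (index_fixator_le _) hLi
        _ = K := by rw [hde, hDe, Nat.mul_comm]
    have hN'0 : (fixatorIn L (H.SE ⟨e, ω⟩)).index ≠ 0 := by
      rw [index_fixatorIn]
      exact Nat.mul_ne_zero (index_fixator_ne_zero _) hLi0
    have hUN' : UE e ≤ fixatorIn L (H.SE ⟨e, ω⟩) :=
      le_of_index_le (UE e) (hUEker e) _ (isOpen_fixatorIn L hL _) hN'0 hN'K
    have hkfix : k ∈ fixator (H.SE ⟨e, ω⟩) := (mem_fixatorIn_iff L _ k).mp (hUN' hkU)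
    exact (mem_fixator_iff _ _).mp hkfix y

/-! ### Consequences: Proposition 3.6 (v) for strictly coherent, and for finite coherent, `G` -/

/-- (C) with the hypothesis localised at `S`: if `UniformSplittingAt S` holds and `S` is tempered,
an object `T → S` whose image in `B^cov(G_S)` is tempered has tempered source.
[cite: MochizukiSemiAnbd2006, Prop 3.6(v) p.40] -/
theorem isTempered_of_toCovering_of_at (hU : S.UniformSplittingAt) (hS : S.IsTempered) (T : Over S)
    (hT' : (S.toCovering.obj T).IsTempered) : T.left.IsTempered := by
  intro p
  obtain ⟨F₀, h0fin, h0ne, h0split⟩ := hS (ptMap T.hom p)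
  obtain ⟨F', hF'fin, hF'ne, hF'split⟩ := hT' (S.ptUp T p)
  obtain ⟨p₀, hp₀⟩ := S.exists_meets T F' hF'ne p
  obtain ⟨F₁, h1fin, h1ne, h1split⟩ := hU F' hF'fin p₀
  obtain ⟨P, π, hPfin, hPne⟩ := exists_finite_dominating ![F₀, F₁]
    (fun i => by fin_cases i <;> assumption) (fun i => by fin_cases i <;> assumption)
  refine ⟨P, hPfin, hPne, fun q hq => ?_⟩
  have hq₀ := h0split _ (sameComponent_map T.hom hq)
  have hq' := hF'split _ (S.sameComponent_ptUp T hq)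
  have hqm := (S.meets_iff_of_sameComponent T F' p₀ hq).mp hp₀
  rcases q with ⟨v, t⟩ | ⟨e, t⟩
  · exact S.splitsAt_inl_of T F' p₀ t (π 0) (π 1) hq₀ hq' hqm h1split
  · exact S.splitsAt_inr_of T F' p₀ t (π 0) (π 1) hq₀ hq' hqm h1split

/-- Localised version of `inverseImage_isTempered_eq`. [cite: MochizukiSemiAnbd2006, Prop 3.6(v) p.40] -/
theorem inverseImage_isTempered_eq_of_at (hU : S.UniformSplittingAt) (hS : S.IsTempered) :
    ObjectProperty.inverseImage (fun T' : CovObj S.coveringGraph => T'.IsTempered)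
        S.coveringEquiv.functor = S.temperedOver := by
  funext T
  exact propext ⟨fun h => S.isTempered_of_toCovering_of_at hU hS T h,
    fun h => S.isTempered_toCovering T h⟩

/-- **`B^temp(G_S) ≌ B^temp(G)_S` from `UniformSplittingAt S`.** [cite: MochizukiSemiAnbd2006, Prop 3.6(v) p.39] -/
def etaleEquivOfAt (hU : S.UniformSplittingAt) (hS : S.IsTempered) :
    BTempCat S.coveringGraph ≌ Over (⟨S, hS⟩ : BTempCat 𝒢) :=
  ((S.overBTempEquiv hS).trans
    (S.coveringEquiv.congrFullSubcategory (S.inverseImage_isTempered_eq_of_at hU hS))).symm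

/-- **Proposition 3.6 (v) for STRICTLY COHERENT `G`, unconditionally**: for `G` as in Prop. 3.6 and
strictly coherent, and `S` tempered, `B^temp(G_S) ≌ B^temp(G)_S`.
[cite: MochizukiSemiAnbd2006, Prop 3.6(v) p.39] -/
def etaleEquivOfStrictlyCoherent (h36 : 𝒢.Prop36Hypotheses) (hsc : 𝒢.IsStrictlyCoherent)
    (hS : S.IsTempered) : BTempCat S.coveringGraph ≌ Over (⟨S, hS⟩ : BTempCat 𝒢) :=
  S.etaleEquivOfAt (S.uniformSplittingAt_of_isStrictlyCoherent h36 hsc hS) hS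

end CovObj

/-- **[IUTchI] Rmk. 2.5.3 (i) (T3): "if `G` is finite and coherent, then it is strictly coherent"**
(a vertex is needed for `N ≥ 1` only nominally: take the maximum of the finitely many generator
counts and `1`). [cite: Mochizuki2012, IUTchI Rem. 2.5.3(i)(T3) p.53] -/
theorem isStrictlyCoherent_of_finite {𝒢 : ProfiniteSemiGraph.{u}} (hfin : 𝒢.graph.IsFinite)
    (hcoh : 𝒢.IsCoherent) : 𝒢.IsStrictlyCoherent := by
  classical
  haveI : Finite 𝒢.graph.Vertex := hfin.finite_vertex
  haveI : Finite 𝒢.graph.Edge := hfin.finite_edge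
  haveI : Fintype 𝒢.graph.Vertex := Fintype.ofFinite _
  haveI : Fintype 𝒢.graph.Edge := Fintype.ofFinite _
  obtain ⟨hq, hV, hE⟩ := hcoh
  choose sV hsV using hV
  choose sE hsE using hE
  refine ⟨⟨hq, fun v => ⟨sV v, hsV v⟩, fun e => ⟨sE e, hsE e⟩⟩,
    ⟨max 1 (max (Finset.univ.sup fun v => (sV v).card) (Finset.univ.sup fun e => (sE e).card)),
      le_max_left _ _, fun v => ⟨sV v, ?_, hsV v⟩, fun e => ⟨sE e, ?_, hsE e⟩⟩⟩
  · exact le_trans (Finset.le_sup (f := fun v => (sV v).card) (Finset.mem_univ v))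
      (le_trans (le_max_left _ _) (le_max_right _ _))
  · exact le_trans (Finset.le_sup (f := fun e => (sE e).card) (Finset.mem_univ e))
      (le_trans (le_max_right _ _) (le_max_right _ _))

/-- **Proposition 3.6 (v) for FINITE coherent `G`, unconditionally** (the case of the dual
semi-graphs of pointed stable curves): for `G` as in Prop. 3.6, coherent, with finite underlying
semi-graph, and `S` tempered, `B^temp(G_S) ≌ B^temp(G)_S`. [cite: MochizukiSemiAnbd2006, Prop 3.6(v) p.39] -/
theorem nonempty_etaleEquiv_of_finite {𝒢 : ProfiniteSemiGraph.{u}} (h36 : 𝒢.Prop36Hypotheses)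
    (hcoh : 𝒢.IsCoherent) (hfin : 𝒢.graph.IsFinite) (S : CovObj 𝒢) (hS : S.IsTempered) :
    Nonempty (BTempCat S.coveringGraph ≌ Over (⟨S, hS⟩ : BTempCat 𝒢)) :=
  ⟨S.etaleEquivOfStrictlyCoherent h36 (isStrictlyCoherent_of_finite hfin hcoh) hS⟩

end ProfiniteSemiGraph

end Literature.AnabelianGeometry.SemiGraphs

end
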